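import Summits.ResolutionOfSingularities.ResolutionOfSingularities.Theses.FoliationDescent
import Summits.ResolutionOfSingularities.ResolutionOfSingularities.Theorems.FoliationDescentDualSandwichRelStep
import Summits.ResolutionOfSingularities.ResolutionOfSingularities.Theorems.FoliationDescentDualSandwichRelChain
import Summits.ResolutionOfSingularities.ResolutionOfSingularities.Theorems.FoliationDescentDualSandwichFrobeniusTop
import HarnessLib

/-!
# Crux `DualSandwich` (stmt-ResolutionOfSingularities-17083) — PROVED (line `birth`)

Route `ResolutionOfSingularities/FoliationDescent`, crux #4 (rank 4, "consumed reduction"):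

  `DualSandwich := FolLU → LogCanQuotLU → TorsorLUPerfect`

— foliation local uniformization (`FolLU`) and log-canonical quotient uniformization
(`LogCanQuotLU`) give local uniformization of `α_p`-torsors `t ^ p = a` over bases `A₀` regular
at the centre, over PERFECT ground fields `k` of characteristic `p`.

Proof (the DOUBLE, reverse-Frobenius, SANDWICH; Temkin 2013, §1.3, Thm. 1.3.2, Rem. 1.3.5):
1. `stub_frobeniusTop` (`Theorems/FoliationDescentDualSandwichFrobeniusTop.lean`): the torsor datum
   `(k, K, O, A₀, t)` has a REGULAR TOP — `L = K(a₁^{1/p}, …, a_m^{1/p})` finite purely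
   inseparable over `K`, `O' = Frob⁻¹ O`, `B = k[a₁^{1/p}, …, a_m^{1/p}] ≅ A₀` (Frobenius; `k`
   perfect) regular at the centre of `O'`, and `R = k[A₀, t] ⊆ B ∩ K`.
2. `stub_relChain` (`…RelChain.lean`): relative descent along the finite purely inseparable `L/K`
   by induction on `[L : K]`, peeling height-one steps `K ⊆ K(y)`, `y ^ p ∈ K`, keeping `R`;
3. each step is `stub_relStep` (`…RelStep.lean`), the ONLY place the route's cruxes are consumed:
   `K(y)/K` is the kernel extension of the `p`-closed derivation `d/dy`; `FolLU` makes it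
   log-canonical on a further regular model, `LogCanQuotLU` uniformizes the constants keeping `R`.
The output `A ⊇ R ∋ t`, `A ⊇ A₀`, `Frac A = K`, regular at the centre of `O' ∩ K = O`, is the
torsor's local uniformization.
-/

noncomputable section

set_option linter.dupNamespace false -- single-problem summit: doubled namespace component is forced

open Summit.ResolutionOfSingularities.ResolutionOfSingularities.Theses.FoliationDescent
  (FolLU LogCanQuotLU TorsorLUPerfect DualSandwich)

namespace Summit.ResolutionOfSingularities.ResolutionOfSingularities.Theorems.DualSandwich.Birth

/-- **The crux `DualSandwich` of route `FoliationDescent`**: `FolLU → LogCanQuotLU →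
TorsorLUPerfect` — local uniformization of `α_p`-torsors over bases regular at the centre, over
perfect ground fields, from foliation local uniformization and log-canonical quotient
uniformization, by the double Frobenius sandwich `K = K₀(t) ⊆ K₀^{1/p} ⊇ A₀^{1/p}` and descent
along degree-`p` steps (`stub_frobeniusTop`, `stub_relChain`, `stub_relStep`).
[cite: Temkin2013, Thm. 1.3.2 and Rem. 1.3.5] -/
theorem DualSandwich_proof : DualSandwich := by
  intro hF hQ p hp k K _ _ _ _ _ O A₀ h₀ t hfg htp hfrac hreg
  obtain ⟨L, _, _, _, _, _, _, O', B, hB, R, hO, hBfg, hBfr, hBreg, hA₀R, htR, hRfg, hRB⟩ :=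
    stub_frobeniusTop p hp k K O A₀ h₀ t hfg htp hfrac hreg
  subst hO
  obtain ⟨A, hA, hRA, hAfg, hAfr, hAreg⟩ :=
    stub_relChain p hp (stub_relStep hF hQ p hp) k K L O' B hB R hBfg hBfr hBreg hRfg hRB
  exact ⟨A, hA, le_trans hA₀R hRA, hRA htR, hAfg, hAfr, hAreg⟩

end Summit.ResolutionOfSingularities.ResolutionOfSingularities.Theorems.DualSandwich.Birth

end
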